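import Summits.CriticalPhenomena.PercolationContinuityZ3.Theorems.PercNearOneGluingNoHeavyConstsClusterSquareMinorBridge
import HarnessLib

/-!
# A cross-linkage at a connected vertex set is a `W₄` minor: no quadruple clash on `W₄`-minor-free (⊇ series-parallel) graphs

builds on p205010 (kernel theorem, internal audit signed; external expert review pending)

PAPER-2 track "percolation constants", part (ii), seat `prim-consts-1`, gen 23 (lane index
`run/shared/lean/prim/consts/CONSTANTS.md`, row A19; memo `FROM-prim-consts-1-g23-SERIES-PARALLEL.md`).
Support file for the crux `NoHeavyLowerTail` (stmt-CriticalPhenomena-4575; `--supports`).  Theorems only (pure graph theory);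
no definitions, no sorries.

THE POINT.  Gen 22 (`Consts.not_quadClash_of_unlinked₄`, `…ApicesQuadLinked.lean`) reduced the hypothesis "no quadruple clash at
`(a; b, c)`" of the two-copy cluster-square criterion (`Consts.clusterSquare_le_sq_of_noQuadClash_pos`, gen 18) to a statement about
the support graph `H` alone: no `H`-connected `K ∋ a` carries a CROSS-LINKAGE — four distinct vertices `y, z, y', z'` outside `K`,
each with a neighbour in `K`, with vertex-disjoint `K`-avoiding walks `R₁ : y → z ∥ R₂ : y' → z'` AND vertex-disjoint `K`-avoiding
walks `R₃ : y' → z ∥ R₄ : y → z'`.  THIS FILE: **a cross-linkage at a connected `K` is a `W₄` (4-wheel) minor whose hub branch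
set contains `K`** (`Consts.noCrossLinkage_of_noW4Minor`).  Proof: pass to paths; inside `R₃` cut a bridge `B : q → p` from `R₁`
to `R₂` (meeting them only at its ends), inside `R₄` a bridge `D : r → s` from `R₁` to `R₂` (`r` = last `R₁`-vertex of `R₄`
before its first `R₂`-vertex `s`); `B ∩ D = ∅`, `r ≠ q`, `s ≠ p`.  Split `R₂` between `p` and `s` into `PP ∋ p`, `SS ∋ s`
(`Consts.Minor.exists_split`).  If `r` precedes `q` on `R₁` the rim is `R₁[y,q) ∪ D° ∣ R₁[q,z] ∪ B° ∣ PP ∣ SS`, otherwise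
`R₁[y,q] ∪ B° ∣ PP ∣ SS ∣ R₁(q,z] ∪ D°` (`°` = without the far end); the hub is `K`, joined to the rim sets through `y, z, y', z'`.
CONVERSELY a `W₄` model gives a cross-linkage at its hub set (take one `K`-neighbour in each rim set), so for the two-copy method
"no cross-linkage at any connected set" and "no `W₄` minor" are the SAME graph class; it contains every `K₄`-minor-free
(= series-parallel = treewidth `≤ 2`, Duffin 1965) graph (`Consts.noCrossLinkage_of_noK4Minor`) and also `K₄` and all `≤ 2`-sums
of `K₄`'s with series-parallel graphs.  The probabilistic consequences (CSQ and DUU at every root, TS for every triple, for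
every weight vector supported on such a graph) are drawn in `…ConstsClusterSquareSeriesParallel.lean`.
Census (lane g23, exact enumeration `prim-consts-1/g23/eng/{k4,w4}_census*.py`, all 12 113 connected graphs on `≤ 8` vertices up
to isomorphism): "some connected `K` carries a cross-linkage" COINCIDES with "`W₄` minor" on every graph (both: 35 / 442 / 8 473
at `n ≤ 6 / = 7 / = 8`; neither: 108 / 411 / 2 644); `K₄`-minor-free graphs (80 / 241 / 1 245) never carry one.
References: R. J. Duffin, J. Math. Anal. Appl. 10 (1965) 303–318; R. Diestel, Graph Theory (5th ed.), §1.7; N. Gladkov,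
arXiv:2408.08457v2 (2024), Thm. 4.3 (the two-copy criterion served).
-/

namespace Summit.CriticalPhenomena.PercolationContinuityZ3.Theorems

namespace Consts

open Minor

/-- **A cross-linkage at a connected set is a `W₄` minor.**  If `H` has no `W₄` minor — no hub set `B₀` and rim sets
`A₁, A₂, A₃, A₄`, pairwise disjoint, each inducing a connected subgraph, the hub joined by `H`-edges to every rim set and the rim
sets joined cyclically `A₁–A₂–A₃–A₄–A₁` — then for EVERY vertex `a` the hypothesis `hK` of `Consts.not_quadClash_of_unlinked₄`
holds: no `H`-connected `K ∋ a` has four distinct outside vertices `y, y', z, z'` with neighbours in `K` such that both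
`y → z ∥ y' → z'` and `y' → z ∥ y → z'` are realised by vertex-disjoint `K`-avoiding walks.
[cite: Diestel2017, §1.7 (minors as branch sets); Duffin1965, Thm. 1 (series-parallel ⟺ no `K₄` subdivision)] -/
theorem noCrossLinkage_of_noW4Minor {V : Type*} [DecidableEq V] (H : SimpleGraph V)
    (hW4 : ∀ B₀ A₁ A₂ A₃ A₄ : Set V,
      (H.induce B₀).Connected → (H.induce A₁).Connected → (H.induce A₂).Connected → (H.induce A₃).Connected →
      (H.induce A₄).Connected →
      Disjoint B₀ A₁ → Disjoint B₀ A₂ → Disjoint B₀ A₃ → Disjoint B₀ A₄ →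
      Disjoint A₁ A₂ → Disjoint A₁ A₃ → Disjoint A₁ A₄ → Disjoint A₂ A₃ → Disjoint A₂ A₄ → Disjoint A₃ A₄ →
      (∃ u ∈ B₀, ∃ v ∈ A₁, H.Adj u v) → (∃ u ∈ B₀, ∃ v ∈ A₂, H.Adj u v) → (∃ u ∈ B₀, ∃ v ∈ A₃, H.Adj u v) →
      (∃ u ∈ B₀, ∃ v ∈ A₄, H.Adj u v) →
      (∃ u ∈ A₁, ∃ v ∈ A₂, H.Adj u v) → (∃ u ∈ A₂, ∃ v ∈ A₃, H.Adj u v) → (∃ u ∈ A₃, ∃ v ∈ A₄, H.Adj u v) →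
      (∃ u ∈ A₄, ∃ v ∈ A₁, H.Adj u v) → False)
    (a : V) :
    ∀ (K : Set V) (y y' z z' : V), a ∈ K →
      (∀ T : Set V, a ∈ T → (∀ u x, u ∈ T → H.Adj u x → x ∈ K → x ∈ T) → K ⊆ T) →
      y ∉ K → y' ∉ K → z ∉ K → z' ∉ K →
      (∃ k, k ∈ K ∧ H.Adj k y) → (∃ k, k ∈ K ∧ H.Adj k y') → (∃ k, k ∈ K ∧ H.Adj k z) → (∃ k, k ∈ K ∧ H.Adj k z') →
      y ≠ y' → y ≠ z → y ≠ z' → y' ≠ z → y' ≠ z' → z ≠ z' →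
      (∀ (R₁ : H.Walk y z) (R₂ : H.Walk y' z'), (∀ x ∈ R₁.support, x ∉ K) → (∀ x ∈ R₂.support, x ∉ K) →
          ∃ x, x ∈ R₁.support ∧ x ∈ R₂.support) ∨
      (∀ (R₃ : H.Walk y' z) (R₄ : H.Walk y z'), (∀ x ∈ R₃.support, x ∉ K) → (∀ x ∈ R₄.support, x ∉ K) →
          ∃ x, x ∈ R₃.support ∧ x ∈ R₄.support) := by
  intro K y y' z z' haK hcl hyK hy'K hzK hz'K hky hky' hkz hkz' _ _ _ _ _ _
  by_contra hcon
  rw [not_or] at hcon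
  obtain ⟨h12, h34⟩ := hcon
  push Not at h12 h34
  obtain ⟨R₁, R₂, hR₁K, hR₂K, hd12⟩ := h12
  obtain ⟨R₃, R₄, hR₃K, hR₄K, hd34⟩ := h34
  -- pass to paths
  set P₁ := R₁.bypass with hP₁def
  set P₂ := R₂.bypass with hP₂def
  set P₃ := R₃.bypass with hP₃def
  set P₄ := R₄.bypass with hP₄def
  have hP₁ : P₁.IsPath := R₁.bypass_isPath
  have hP₂ : P₂.IsPath := R₂.bypass_isPath
  have hP₃ : P₃.IsPath := R₃.bypass_isPath
  have hP₄ : P₄.IsPath := R₄.bypass_isPath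
  have hP₁K : ∀ x ∈ P₁.support, x ∉ K := fun x hx => hR₁K x (R₁.support_bypass_subset_support hx)
  have hP₂K : ∀ x ∈ P₂.support, x ∉ K := fun x hx => hR₂K x (R₂.support_bypass_subset_support hx)
  have hP₃K : ∀ x ∈ P₃.support, x ∉ K := fun x hx => hR₃K x (R₃.support_bypass_subset_support hx)
  have hP₄K : ∀ x ∈ P₄.support, x ∉ K := fun x hx => hR₄K x (R₄.support_bypass_subset_support hx)
  have hP12 : ∀ x, x ∈ P₁.support → x ∉ P₂.support := fun x hx hx' =>
    hd12 x (R₁.support_bypass_subset_support hx) (R₂.support_bypass_subset_support hx')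
  have hP34 : ∀ x, x ∈ P₃.support → x ∉ P₄.support := fun x hx hx' =>
    hd34 x (R₃.support_bypass_subset_support hx) (R₄.support_bypass_subset_support hx')
  -- bridge 1 (inside `P₃`): `Bq : q → p`, `q ∈ P₁`, `p ∈ P₂`, meeting `P₁` only at `q` and `P₂` only at `p`
  obtain ⟨q, p, Bq, hqS, hpT, hBq3', hBq1', hBq2', hBqpath'⟩ := exists_bridge P₃.reverse P₁.support.toFinset P₂.support.toFinset
    (List.mem_toFinset.mpr P₁.end_mem_support) (List.mem_toFinset.mpr P₂.start_mem_support)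
  have hq1 : q ∈ P₁.support := List.mem_toFinset.mp hqS
  have hp2 : p ∈ P₂.support := List.mem_toFinset.mp hpT
  have hBq3 : ∀ x ∈ Bq.support, x ∈ P₃.support := fun x hx => by
    have h := hBq3' x hx; rwa [SimpleGraph.Walk.support_reverse, List.mem_reverse] at h
  have hBq1 : ∀ x ∈ Bq.support, x ∈ P₁.support → x = q := fun x hx hx1 => hBq1' x hx (List.mem_toFinset.mpr hx1)
  have hBq2 : ∀ x ∈ Bq.support, x ∈ P₂.support → x = p := fun x hx hx2 => hBq2' x hx (List.mem_toFinset.mpr hx2)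
  have hBqpath : Bq.IsPath := hBqpath' hP₃.reverse
  have hq3 : q ∈ P₃.support := hBq3 q Bq.start_mem_support
  have hp3 : p ∈ P₃.support := hBq3 p Bq.end_mem_support
  have hqy : q ≠ y := fun h => hP34 q hq3 (h ▸ P₄.start_mem_support)
  have hpq : p ≠ q := fun h => hP12 q hq1 (h ▸ hp2)
  -- bridge 2 (inside `P₄`): `D : r → s`, `r ∈ P₁`, `s ∈ P₂`, meeting `P₁` only at `r` and `P₂` only at `s`
  obtain ⟨r, s, D, hrS, hsT, hD4, hD1', hD2', hDpath'⟩ := exists_bridge P₄ P₁.support.toFinset P₂.support.toFinset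
    (List.mem_toFinset.mpr P₁.start_mem_support) (List.mem_toFinset.mpr P₂.end_mem_support)
  have hr1 : r ∈ P₁.support := List.mem_toFinset.mp hrS
  have hs2 : s ∈ P₂.support := List.mem_toFinset.mp hsT
  have hD1 : ∀ x ∈ D.support, x ∈ P₁.support → x = r := fun x hx hx1 => hD1' x hx (List.mem_toFinset.mpr hx1)
  have hD2 : ∀ x ∈ D.support, x ∈ P₂.support → x = s := fun x hx hx2 => hD2' x hx (List.mem_toFinset.mpr hx2)
  have hDpath : D.IsPath := hDpath' hP₄
  have hr4 : r ∈ P₄.support := hD4 r D.start_mem_support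
  have hs4 : s ∈ P₄.support := hD4 s D.end_mem_support
  have hrq : r ≠ q := fun h => hP34 q hq3 (h ▸ hr4)
  have hps : p ≠ s := fun h => hP34 p hp3 (h ▸ hs4)
  have hrs : r ≠ s := fun h => hP12 r hr1 (h ▸ hs2)
  have hDBq : ∀ x, x ∈ D.support → x ∉ Bq.support := fun x hx hx' => hP34 x (hBq3 x hx') (hD4 x hx)
  -- `D.reverse = s · D''`
  obtain ⟨s₁, hss₁, D'', hD''⟩ := exists_cons D.reverse hrs.symm
  have hD''D : ∀ x ∈ D''.support, x ∈ D.support := fun x hx => by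
    have h : x ∈ D.reverse.support := by rw [hD'']; exact List.mem_cons_of_mem _ hx
    rwa [SimpleGraph.Walk.support_reverse, List.mem_reverse] at h
  have hsD'' : s ∉ D''.support := by
    intro h
    have hnd := hDpath.reverse.support_nodup
    rw [hD'', List.nodup_cons] at hnd
    exact hnd.1 h
  have hrD'' : r ∈ D''.support := D''.end_mem_support
  have hs₁D'' : s₁ ∈ D''.support := D''.start_mem_support
  have hD''2 : ∀ x ∈ D''.support, x ∉ P₂.support := fun x hx hx2 => hsD'' ((hD2 x (hD''D x hx) hx2) ▸ hx)
  -- `Bq.reverse = p · B''`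
  obtain ⟨p₁, hpp₁, B'', hB''⟩ := exists_cons Bq.reverse hpq
  have hB''B : ∀ x ∈ B''.support, x ∈ Bq.support := fun x hx => by
    have h : x ∈ Bq.reverse.support := by rw [hB'']; exact List.mem_cons_of_mem _ hx
    rwa [SimpleGraph.Walk.support_reverse, List.mem_reverse] at h
  have hpB'' : p ∉ B''.support := by
    intro h
    have hnd := hBqpath.reverse.support_nodup
    rw [hB'', List.nodup_cons] at hnd
    exact hnd.1 h
  have hqB'' : q ∈ B''.support := B''.end_mem_support
  have hB''2 : ∀ x ∈ B''.support, x ∉ P₂.support := fun x hx hx2 => hpB'' ((hBq2 x (hB''B x hx) hx2) ▸ hx)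
  -- split `P₂` between `p` and `s`
  obtain ⟨PP, SS, hcPP, hcSS, hdPS, hpPP, hsSS, ⟨m, hmPP, hms⟩, hPP2, hSS2, hends⟩ := exists_split P₂ hP₂ hp2 hs2 hps
  have hKPP : ∃ u ∈ K, ∃ v ∈ PP, H.Adj u v := by
    rcases hends with ⟨hy', _⟩ | ⟨_, hz'⟩
    · obtain ⟨k, hk, hk'⟩ := hky'; exact ⟨k, hk, y', hy', hk'⟩
    · obtain ⟨k, hk, hk'⟩ := hkz'; exact ⟨k, hk, z', hz', hk'⟩
  have hKSS : ∃ u ∈ K, ∃ v ∈ SS, H.Adj u v := by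
    rcases hends with ⟨_, hz'⟩ | ⟨hy', _⟩
    · obtain ⟨k, hk, hk'⟩ := hkz'; exact ⟨k, hk, z', hz', hk'⟩
    · obtain ⟨k, hk, hk'⟩ := hky'; exact ⟨k, hk, y', hy', hk'⟩
  have hcK : (H.induce K).Connected := induce_connected_of_closure haK hcl
  have hKPPd : Disjoint K PP := Set.disjoint_left.mpr fun x hxK hx => hP₂K x (hPP2 x hx) hxK
  have hKSSd : Disjoint K SS := Set.disjoint_left.mpr fun x hxK hx => hP₂K x (hSS2 x hx) hxK
  -- split `P₁` at `q`
  set P₁a := P₁.takeUntil q hq1 with hP₁adef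
  set P₁b := P₁.dropUntil q hq1 with hP₁bdef
  have hP₁a1 : ∀ x ∈ P₁a.support, x ∈ P₁.support := fun x hx => P₁.support_takeUntil_subset_support hq1 hx
  have hP₁b1 : ∀ x ∈ P₁b.support, x ∈ P₁.support := fun x hx => P₁.support_dropUntil_subset_support hq1 hx
  have hab : ∀ x, x ∈ P₁a.support → x ∈ P₁b.support → x = q := takeUntil_dropUntil_disjoint P₁ hP₁ hq1
  have hP₁apath : P₁a.IsPath := hP₁.takeUntil hq1
  have hP₁bpath : P₁b.IsPath := hP₁.dropUntil hq1
  have hr1' : r ∈ P₁a.support ∨ r ∈ P₁b.support := by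
    have h := hr1
    rw [← P₁.take_spec hq1, SimpleGraph.Walk.mem_support_append_iff] at h
    exact h
  rcases hr1' with hra | hrb
  · -- CASE I: `r` precedes `q` on `R₁`.  Rim `R₁[y,q) ∪ D° ∣ R₁[q,z] ∪ B° ∣ PP ∣ SS`, hub `K`.
    obtain ⟨q₁, hqq₁, W₁, hW₁⟩ := exists_cons P₁a.reverse hqy
    have hW₁a : ∀ x ∈ W₁.support, x ∈ P₁a.support := fun x hx => by
      have h : x ∈ P₁a.reverse.support := by rw [hW₁]; exact List.mem_cons_of_mem _ hx
      rwa [SimpleGraph.Walk.support_reverse, List.mem_reverse] at h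
    have hqW₁ : q ∉ W₁.support := by
      intro h
      have hnd := hP₁apath.reverse.support_nodup
      rw [hW₁, List.nodup_cons] at hnd
      exact hnd.1 h
    have hrW₁ : r ∈ W₁.support := by
      have h : r ∈ P₁a.reverse.support := by
        rw [SimpleGraph.Walk.support_reverse, List.mem_reverse]; exact hra
      rw [hW₁, List.mem_cons] at h
      exact h.resolve_left hrq
    set Y : Set V := {t | t ∈ W₁.support} ∪ {t | t ∈ D''.support} with hYdef
    set Q : Set V := {t | t ∈ P₁b.support} ∪ {t | t ∈ B''.support} with hQdef
    have hY1 : ∀ x ∈ Y, (x ∈ P₁a.support ∧ x ≠ q) ∨ x ∈ D''.support := by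
      intro x hx
      rcases hx with hx | hx
      · exact Or.inl ⟨hW₁a x hx, fun h => hqW₁ (h ▸ hx)⟩
      · exact Or.inr hx
    have hY2 : ∀ x ∈ Y, x ∉ P₂.support := by
      intro x hx hx2
      rcases hx with hx | hx
      · exact hP12 x (hP₁a1 x (hW₁a x hx)) hx2
      · exact hD''2 x hx hx2
    have hQ2 : ∀ x ∈ Q, x ∉ P₂.support := by
      intro x hx hx2
      rcases hx with hx | hx
      · exact hP12 x (hP₁b1 x hx) hx2
      · exact hB''2 x hx hx2
    refine hW4 K Y Q PP SS hcK (induce_connected_union W₁ D'' r hrW₁ hrD'')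
      (induce_connected_union P₁b B'' q P₁b.start_mem_support hqB'') hcPP hcSS ?_ ?_ hKPPd hKSSd ?_ ?_ ?_ ?_ ?_ hdPS
      ?_ ?_ hKPP hKSS ?_ ?_ ⟨m, hmPP, s, hsSS, hms⟩ ?_
    · refine Set.disjoint_left.mpr fun x hxK hx => ?_
      rcases hx with hx | hx
      · exact hP₁K x (hP₁a1 x (hW₁a x hx)) hxK
      · exact hP₄K x (hD4 x (hD''D x hx)) hxK
    · refine Set.disjoint_left.mpr fun x hxK hx => ?_
      rcases hx with hx | hx
      · exact hP₁K x (hP₁b1 x hx) hxK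
      · exact hP₃K x (hBq3 x (hB''B x hx)) hxK
    · refine Set.disjoint_left.mpr fun x hx1 hx2 => ?_
      rcases hY1 x hx1 with ⟨hxa, hxq⟩ | hxD
      · rcases hx2 with hx | hx
        · exact hxq (hab x hxa hx)
        · exact hxq (hBq1 x (hB''B x hx) (hP₁a1 x hxa))
      · rcases hx2 with hx | hx
        · have hxr : x = r := hD1 x (hD''D x hxD) (hP₁b1 x hx)
          exact hrq (hab r hra (hxr ▸ hx))
        · exact hDBq x (hD''D x hxD) (hB''B x hx)
    · exact Set.disjoint_left.mpr fun x hx1 hx2 => hY2 x hx1 (hPP2 x hx2)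
    · exact Set.disjoint_left.mpr fun x hx1 hx2 => hY2 x hx1 (hSS2 x hx2)
    · exact Set.disjoint_left.mpr fun x hx1 hx2 => hQ2 x hx1 (hPP2 x hx2)
    · exact Set.disjoint_left.mpr fun x hx1 hx2 => hQ2 x hx1 (hSS2 x hx2)
    · obtain ⟨k, hk, hk'⟩ := hky
      exact ⟨k, hk, y, Or.inl W₁.end_mem_support, hk'⟩
    · obtain ⟨k, hk, hk'⟩ := hkz
      exact ⟨k, hk, z, Or.inl P₁b.end_mem_support, hk'⟩
    · exact ⟨q₁, Or.inl W₁.start_mem_support, q, Or.inl P₁b.start_mem_support, hqq₁.symm⟩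
    · exact ⟨p₁, Or.inr B''.start_mem_support, p, hpPP, hpp₁.symm⟩
    · exact ⟨s, hsSS, s₁, Or.inr hs₁D'', hss₁⟩
  · -- CASE II: `r` follows `q` on `R₁`.  Rim `R₁[y,q] ∪ B° ∣ PP ∣ SS ∣ R₁(q,z] ∪ D°`, hub `K`.
    have hqz : q ≠ z := by
      rintro rfl
      have hnil : P₁b.support = [q] :=
        SimpleGraph.Walk.nil_iff_support_eq.mp (SimpleGraph.Walk.isPath_iff_nil.mp hP₁bpath)
      have : r ∈ [q] := hnil ▸ hrb
      rw [List.mem_singleton] at this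
      exact hrq this
    obtain ⟨q₂, hqq₂, W₂, hW₂⟩ := exists_cons P₁b hqz
    have hW₂b : ∀ x ∈ W₂.support, x ∈ P₁b.support := fun x hx => by rw [hW₂]; exact List.mem_cons_of_mem _ hx
    have hqW₂ : q ∉ W₂.support := by
      intro h
      have hnd := hP₁bpath.support_nodup
      rw [hW₂, List.nodup_cons] at hnd
      exact hnd.1 h
    have hrW₂ : r ∈ W₂.support := by
      have h := hrb; rw [hW₂, List.mem_cons] at h
      exact h.resolve_left hrq
    set A₁ : Set V := {t | t ∈ P₁a.support} ∪ {t | t ∈ B''.support} with hA₁def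
    set A₂ : Set V := {t | t ∈ W₂.support} ∪ {t | t ∈ D''.support} with hA₂def
    have hA₁2 : ∀ x ∈ A₁, x ∉ P₂.support := by
      intro x hx hx2
      rcases hx with hx | hx
      · exact hP12 x (hP₁a1 x hx) hx2
      · exact hB''2 x hx hx2
    have hA₂2 : ∀ x ∈ A₂, x ∉ P₂.support := by
      intro x hx hx2
      rcases hx with hx | hx
      · exact hP12 x (hP₁b1 x (hW₂b x hx)) hx2
      · exact hD''2 x hx hx2
    -- rim order `A₁ – PP – SS – A₂ – A₁`
    refine hW4 K A₁ PP SS A₂ hcK (induce_connected_union P₁a B'' q P₁a.end_mem_support hqB'') hcPP hcSS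
      (induce_connected_union W₂ D'' r hrW₂ hrD'') ?_ hKPPd hKSSd ?_ ?_ ?_ ?_ hdPS ?_ ?_ ?_ hKPP hKSS ?_ ?_
      ⟨m, hmPP, s, hsSS, hms⟩ ?_ ?_
    · refine Set.disjoint_left.mpr fun x hxK hx => ?_
      rcases hx with hx | hx
      · exact hP₁K x (hP₁a1 x hx) hxK
      · exact hP₃K x (hBq3 x (hB''B x hx)) hxK
    · refine Set.disjoint_left.mpr fun x hxK hx => ?_
      rcases hx with hx | hx
      · exact hP₁K x (hP₁b1 x (hW₂b x hx)) hxK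
      · exact hP₄K x (hD4 x (hD''D x hx)) hxK
    · exact Set.disjoint_left.mpr fun x hx1 hx2 => hA₁2 x hx1 (hPP2 x hx2)
    · exact Set.disjoint_left.mpr fun x hx1 hx2 => hA₁2 x hx1 (hSS2 x hx2)
    · refine Set.disjoint_left.mpr fun x hx1 hx2 => ?_
      rcases hx1 with hxa | hxB
      · rcases hx2 with hx | hx
        · exact hqW₂ ((hab x hxa (hW₂b x hx)) ▸ hx)
        · have hxr : x = r := hD1 x (hD''D x hx) (hP₁a1 x hxa)
          exact hrq (hab r (hxr ▸ hxa) hrb)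
      · rcases hx2 with hx | hx
        · exact hqW₂ ((hBq1 x (hB''B x hxB) (hP₁b1 x (hW₂b x hx))) ▸ hx)
        · exact hDBq x (hD''D x hx) (hB''B x hxB)
    · exact Set.disjoint_left.mpr fun x hx1 hx2 => hA₂2 x hx2 (hPP2 x hx1)
    · exact Set.disjoint_left.mpr fun x hx1 hx2 => hA₂2 x hx2 (hSS2 x hx1)
    · obtain ⟨k, hk, hk'⟩ := hky
      exact ⟨k, hk, y, Or.inl P₁a.start_mem_support, hk'⟩
    · obtain ⟨k, hk, hk'⟩ := hkz
      exact ⟨k, hk, z, Or.inl W₂.end_mem_support, hk'⟩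
    · exact ⟨p₁, Or.inr B''.start_mem_support, p, hpPP, hpp₁.symm⟩
    · exact ⟨s, hsSS, s₁, Or.inr hs₁D'', hss₁⟩
    · exact ⟨q₂, Or.inl W₂.start_mem_support, q, Or.inl P₁a.end_mem_support, hqq₂.symm⟩

/-- **Series-parallel form.**  If `H` has no `K₄` minor (no four pairwise disjoint vertex sets, each inducing a connected subgraph,
pairwise joined by `H`-edges — the series-parallel graphs, Duffin 1965) then no connected set carries a cross-linkage: the
hypothesis `hK` of `Consts.not_quadClash_of_unlinked₄` holds at every root `a`.
[cite: Duffin1965, Thm. 1 (series-parallel ⟺ no `K₄` subdivision); Diestel2017, §1.7] -/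
theorem noCrossLinkage_of_noK4Minor {V : Type*} [DecidableEq V] (H : SimpleGraph V)
    (hK4 : ∀ B₀ B₁ B₂ B₃ : Set V,
      (H.induce B₀).Connected → (H.induce B₁).Connected → (H.induce B₂).Connected → (H.induce B₃).Connected →
      Disjoint B₀ B₁ → Disjoint B₀ B₂ → Disjoint B₀ B₃ → Disjoint B₁ B₂ → Disjoint B₁ B₃ → Disjoint B₂ B₃ →
      (∃ u ∈ B₀, ∃ v ∈ B₁, H.Adj u v) → (∃ u ∈ B₀, ∃ v ∈ B₂, H.Adj u v) → (∃ u ∈ B₀, ∃ v ∈ B₃, H.Adj u v) →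
      (∃ u ∈ B₁, ∃ v ∈ B₂, H.Adj u v) → (∃ u ∈ B₁, ∃ v ∈ B₃, H.Adj u v) → (∃ u ∈ B₂, ∃ v ∈ B₃, H.Adj u v) → False)
    (a : V) :
    ∀ (K : Set V) (y y' z z' : V), a ∈ K →
      (∀ T : Set V, a ∈ T → (∀ u x, u ∈ T → H.Adj u x → x ∈ K → x ∈ T) → K ⊆ T) →
      y ∉ K → y' ∉ K → z ∉ K → z' ∉ K →
      (∃ k, k ∈ K ∧ H.Adj k y) → (∃ k, k ∈ K ∧ H.Adj k y') → (∃ k, k ∈ K ∧ H.Adj k z) → (∃ k, k ∈ K ∧ H.Adj k z') →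
      y ≠ y' → y ≠ z → y ≠ z' → y' ≠ z → y' ≠ z' → z ≠ z' →
      (∀ (R₁ : H.Walk y z) (R₂ : H.Walk y' z'), (∀ x ∈ R₁.support, x ∉ K) → (∀ x ∈ R₂.support, x ∉ K) →
          ∃ x, x ∈ R₁.support ∧ x ∈ R₂.support) ∨
      (∀ (R₃ : H.Walk y' z) (R₄ : H.Walk y z'), (∀ x ∈ R₃.support, x ∉ K) → (∀ x ∈ R₄.support, x ∉ K) →
          ∃ x, x ∈ R₃.support ∧ x ∈ R₄.support) :=
  noCrossLinkage_of_noW4Minor H (noW4Minor_of_noK4Minor hK4) a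

end Consts

end Summit.CriticalPhenomena.PercolationContinuityZ3.Theorems
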